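import Summits.ResolutionOfSingularities.ResolutionOfSingularities.Theorems.FrobeniusClosingPatchingRelPerfectDepthTargetsR5HIntegral
import Summits.ResolutionOfSingularities.ResolutionOfSingularities.Theorems.FrobeniusClosingPatchingRelPerfectDepthHLedInitial
import Summits.ResolutionOfSingularities.ResolutionOfSingularities.Theorems.FrobeniusClosingPatchingRelPerfectDepthHLedStep
import Summits.ResolutionOfSingularities.ResolutionOfSingularities.Theorems.FrobeniusClosingPatchingRelPerfectDepthHSepGameHolds
import HarnessLib

/-!
# `PatchingRelPerfect` (stmt-ResolutionOfSingularities-16161), chain W5.2 — rung R5ᴴ CLOSED modulo [F-32bR]: the hypersurface-led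
# member corollary of the CORE

[OURS · L1 W5.2 · res-D-pv-055, owner of R5ᴴ (plan-1 RULINGS G10-2, G10-3, G11-4)] **`hLedMember_atomConclusion_holds`** — the
conclusion of the CORE (`PatchingRelPerfect`'s atom: every blowing up `T = Bl_I Spec S` is dominated by a further blowing up along a
non-zero ideal cosupported over the closed point with regular source) for every hypersurface-led one-form member
`I = (σP₀(x) + σP₁(x) + G) + (x_k^{d+ℓ})` of every depth `ℓ ≥ 1` of a complete regular local ring of dimension four with a coefficient
field, CONDITIONAL on the named fact `CossartJannsenSaito2020EmbeddedSequenceB` only: `hLedMemberI_atomConclusion_of_targets` (T-R5Hb)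
fed with N1 `hLedInitial`, N6 `hSepGame₃_of_cjsB`, N2 `hLedStepI`, the binder `I ≠ ⊥` discharged by `oneFormMemberIdeal_ne_bot`.

Honest framing: OURS (AI-written, weaker than expert review); a rung of our own route, conditional on the typed statement of
CJS 2020 Thm. 1.4 (functor B) which the tree does not prove; nothing here is a statement of the manuscript under review.

## Sources
* V. Cossart, U. Jannsen, S. Saito, *Desingularization: invariants and strategy*, LNM 2270 (2020), Thm. 1.4. [CossartJannsenSaito2020]
* J. Kollár, *Lectures on Resolution of Singularities* (2007), (3.111) Step 3. [Kollar2007]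
* H. Kawanoue, K. Matsuki (2016), §2. [KawanoueMatsuki2016]
-/

set_option linter.dupNamespace false -- mandated namespace of this single-conjunct summit

noncomputable section

open CategoryTheory CategoryTheory.Limits AlgebraicGeometry TopologicalSpace IsLocalRing
open Literature.AlgebraicGeometry.Resolution Scheme.IdealSheafData

namespace Summit.ResolutionOfSingularities.ResolutionOfSingularities.Theorems.DepthTargets

universe u

/-- **RUNG R5ᴴ — THE CORE FOR HYPERSURFACE-LED ONE-FORM MEMBERS OF EVERY DEPTH, modulo CJS-B.** Let `S` be a complete regular
local ring of dimension four with a coefficient field `σ : κ₀ → S` (`residue ∘ σ` bijective), `x` generators of `𝔪`, `d ≥ 1`,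
`ℓ ≥ 1`, `P₀ ≠ 0` a form of degree `d`, `P₁` a form of degree `d + 1`, `G ∈ 𝔪^{d+2}`, `f = σP₀(x) + σP₁(x) + G` with `(f)` prime,
and `(P₀, P₁)` hypersurface-led. Then for every blowing up `T = Bl_I Spec S`, `I = (f) + (x_k^{d+ℓ})_k`, there is a further
blowing up `T' → T` along a non-zero ideal sheaf cosupported over the closed point with `T'` regular — GIVEN the
Cossart–Jannsen–Saito embedded resolution of two-dimensional excellent schemes with boundary (functor B).
[cite: CossartJannsenSaito2020, Thm. 1.4] [cite: Kollar2007, (3.111) Step 3] [cite: KawanoueMatsuki2016, §2] -/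
theorem hLedMember_atomConclusion_holds (hCJS : CossartJannsenSaito2020EmbeddedSequenceB.{u})
    (S : Type u) [CommRing S] [IsRegularLocalRing S] [IsAdicComplete (IsLocalRing.maximalIdeal S) S]
    (hdim : ringKrullDim S = (3 + 1 : ℕ))
    (κ₀ : Type u) [Field κ₀] (σ : κ₀ →+* S) (hσ : Function.Bijective ⇑((IsLocalRing.residue S).comp σ))
    (x : Fin (3 + 1) → S) (hx : Ideal.span (Set.range x) = IsLocalRing.maximalIdeal S)
    (d ℓ : ℕ) (P₀ : Fin 1 → MvPolynomial (Fin (3 + 1)) κ₀)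
    (hP₀ : ∀ l, P₀ l ∈ MvPolynomial.homogeneousSubmodule (Fin (3 + 1)) κ₀ d)
    (P₁ : Fin 1 → MvPolynomial (Fin (3 + 1)) κ₀)
    (hP₁ : ∀ l, P₁ l ∈ MvPolynomial.homogeneousSubmodule (Fin (3 + 1)) κ₀ (d + 1))
    (G : Fin 1 → S) (hG : ∀ l, G l ∈ IsLocalRing.maximalIdeal S ^ (d + 2)) (hP00 : P₀ 0 ≠ 0) (hd : 1 ≤ d) (hℓ : 1 ≤ ℓ)
    (hprime : (Ideal.span {MvPolynomial.eval₂Hom σ x (P₀ 0) + MvPolynomial.eval₂Hom σ x (P₁ 0) + G 0}).IsPrime)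
    (hled : IsHypersurfaceLed κ₀ d P₀ P₁ hP₀ hP₁)
    (T : Scheme.{u}) (f : T ⟶ Spec (.of S)) (hf : IsBlowup f (affineBlowup.idealSheaf (oneFormMemberIdeal σ x d ℓ P₀ P₁ G))) :
    ∃ (J : T.IdealSheafData) (T' : Scheme.{u}) (π : T' ⟶ T), J ≠ ⊥ ∧
      (∀ t : T, t ∈ J.support → f.base t = IsLocalRing.closedPoint S) ∧
      IsBlowup π J ∧ Scheme.IsRegular T' :=
  hLedMemberI_atomConclusion_of_targets hLedInitial (hSepGame₃_of_cjsB hCJS) hLedStepI S hdim κ₀ σ hσ x hx d ℓ P₀ hP₀ P₁ hP₁ G hG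
    hP00 hd hℓ hprime hled (oneFormMemberIdeal_ne_bot hdim σ x hx d ℓ P₀ P₁ G) T f hf

end Summit.ResolutionOfSingularities.ResolutionOfSingularities.Theorems.DepthTargets

end
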